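import Summits.RiemannHypothesis.RiemannHypothesis.Theorems.WeilFormatCDataA1FrontData
import HarnessLib

/-!
# Format C kernel rung `A1` (a = 1/1, column-band layout): even sector: certified column digits, rows 125…149 (kernel certificates)

Window `a = 1/1`; prime powers in the window: 2, 3, 2^2, 5, 7; prime constant A = 2027/1000 (`WeilFormatC.primeCoeff_form_ge_cells_one_v2`); evaluator parameters S = 2^256, Kpi 130, Kser 150, kred 8, Kexp 45, J 120; full table modes < 161; light column table modes < 1027; units 2^-250 (Schur entries), 2^-124 (column digits, width 127), 2^-118 (tail-factor digits, width 121), 2^-64 (reciprocal weights), 2^-40 (tail base); order-J tail J = 4, θ = 1/2048, η = 1/10 | 4/1.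
Design row: weil-2 gen6 candidate (HOME INBOX l.2038): EVEN 160/512 MS-tail, ODD 160/1024 MS-tail; sizing lineage PRODUCTION-TABLE v2.1 bb57741022c05245. Generated by rh-explicit-weil-2 gen7 (gen7/gramgen7.py sha16 8036b365e32639e1) from `#eval` of the tree's `Encl` functions; every datum is re-verified by the kernel in the theorem files (`decide +kernel`). Helper data of the rh-explicit Weil-positivity programme (format C, K-CELL-2), RH-free. [cite: Yoshida1992HermitianForms, §5 (5.15)-(5.16) p. 301; §7 pp. 305–312]
K layout (weil-2 gen12): kernel certificates only — this file imports DATA modules and Literature checkers and is independent of every other certificate file of the rung; the propositional assembly lives in `WeilFormatCDataA1Common` / `…CBEvenAsm` / `…CBOddAsm`.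
-/

set_option linter.dupNamespace false
set_option maxRecDepth 200000

namespace Summit.RiemannHypothesis.RiemannHypothesis.Theorems.WeilFormatCData.A1CBEven
open Literature.NumberTheory.LFunctions Literature.NumberTheory.LFunctions.Yoshida1992 Encl Literature.Analysis.ValidatedNumerics.NumericsMP
open Summit.RiemannHypothesis.RiemannHypothesis.Theorems.WeilFormatCData.A1

set_option maxHeartbeats 0 in  -- kernel evaluation of literal data; no search
/-- kernel: column digits of rows `[125, 130)` against the column boxes. -/
theorem tCol125 : checkRect (2 ^ 256) 124 (ρc : ℤ) 127 160 (2 ^ (127 - 1)) (fun i t ↦ sectorColBox false (2 ^ 256) C tab ctab i (160 + t)) XP 125 5 0 160 = true := by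
  decide +kernel

set_option maxHeartbeats 0 in  -- kernel evaluation of literal data; no search
/-- kernel: column digits of rows `[130, 135)` against the column boxes. -/
theorem tCol130 : checkRect (2 ^ 256) 124 (ρc : ℤ) 127 160 (2 ^ (127 - 1)) (fun i t ↦ sectorColBox false (2 ^ 256) C tab ctab i (160 + t)) XP 130 5 0 160 = true := by
  decide +kernel

set_option maxHeartbeats 0 in  -- kernel evaluation of literal data; no search
/-- kernel: column digits of rows `[135, 140)` against the column boxes. -/
theorem tCol135 : checkRect (2 ^ 256) 124 (ρc : ℤ) 127 160 (2 ^ (127 - 1)) (fun i t ↦ sectorColBox false (2 ^ 256) C tab ctab i (160 + t)) XP 135 5 0 160 = true := by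
  decide +kernel

set_option maxHeartbeats 0 in  -- kernel evaluation of literal data; no search
/-- kernel: column digits of rows `[140, 145)` against the column boxes. -/
theorem tCol140 : checkRect (2 ^ 256) 124 (ρc : ℤ) 127 160 (2 ^ (127 - 1)) (fun i t ↦ sectorColBox false (2 ^ 256) C tab ctab i (160 + t)) XP 140 5 0 160 = true := by
  decide +kernel

set_option maxHeartbeats 0 in  -- kernel evaluation of literal data; no search
/-- kernel: column digits of rows `[145, 150)` against the column boxes. -/
theorem tCol145 : checkRect (2 ^ 256) 124 (ρc : ℤ) 127 160 (2 ^ (127 - 1)) (fun i t ↦ sectorColBox false (2 ^ 256) C tab ctab i (160 + t)) XP 145 5 0 160 = true := by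
  decide +kernel

end Summit.RiemannHypothesis.RiemannHypothesis.Theorems.WeilFormatCData.A1CBEven
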